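import Literature.NumberTheory.CubicFields.CubicFieldDiscriminantThirtyOneHilbertClassField
import Mathlib.NumberTheory.NumberField.ClassNumber
import Mathlib.NumberTheory.NumberField.Units.DirichletTheorem
import HarnessLib

/-!
# The cubic field of discriminant `−31`: signature `(1, 1)`, class number `1` (Minkowski's bound), unit rank `1`
# (LMFDB number field 3.1.31.1) — PROVED

Topic `Literature/NumberTheory/CubicFields`, namespace `Literature.NumberTheory.CubicFields.CubicDisc31` (sequel of
`CubicFieldDiscriminantThirtyOneHilbertClassField.lean`, which proves `d_F = −31` for a cubic field `F ∋ α`, `α³ + α − 1 = 0`; the companion of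
`CubicFieldDiscriminantTwentyThreeClassNumber.lean` for `−23`).  THEOREMS ONLY (no definition, no named fact, no instance, no notation);
lane `lit-hodgefound` seat p25 gen 53, row g53-#9.

## Source

[LMFDB] The L-functions and Modular Forms Database, number field `3.1.31.1` (the cubic field of discriminant `−31`; it is unique — e.g.
`ℚ(α)`, `α³ + α − 1 = 0`, Serre's polynomial in [SerreDurham1977] §7.3): degree `3`, signature `[1, 1]`, discriminant `−31`, class number `1`,
unit rank `1`, torsion order `2` (table entries).

## What is formalised (all PROVED; `F` any number field with `[F : ℚ] = 3` containing a root `α` of `X³ + X − 1`)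

* ★`nrComplexPlaces_eq_one`, `nrRealPlaces_eq_one`, `card_infinitePlace_eq_two` — **signature `(1, 1)`** (`sign d_F = (−1)^{r₂}` with
  `d_F = −31 < 0`, `r₁ + 2r₂ = 3`).
* ★★`isPrincipalIdealRing`, `classNumber_eq_one` — **`h_F = 1`** by Minkowski's bound in Mathlib's form
  `RingOfIntegers.isPrincipalIdealRing_of_abs_discr_lt`: `|d_F| = 31 < (2 · (π/4) · 3³/3!)² = 81π²/16 ≈ 49.96`.
* `units_rank_eq_one` (`r₁ + r₂ − 1 = 1`).  (`w_F = 2` is the tree's degree-3 statement `CubicDisc23.torsionOrder_eq_two`, not restated.)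

## Mathlib / tree search
Tree: `CubicDisc31.discr_eq_neg_thirtyOne` (g53-#8).  Mathlib: `NumberField.sign_discr`, `InfinitePlace.card_add_two_mul_card_eq_rank`,
`card_eq_nrRealPlaces_add_nrComplexPlaces`, `RingOfIntegers.isPrincipalIdealRing_of_abs_discr_lt`, `classNumber_eq_one_iff`, `Units.rank`,
`Real.pi_gt_three`.  `rg "ThirtyOne|CubicDisc31" lean/Literature` → only g53-#8: these invariants are new.

## References
* [LMFDB] The LMFDB Collaboration, The L-functions and Modular Forms Database, number field 3.1.31.1.
* [SerreDurham1977] J.-P. Serre, *Modular forms of weight one and Galois representations* (Durham 1977), §7.3.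
-/

noncomputable section

open NumberField NumberField.InfinitePlace NumberField.Units Ideal Module
open Literature.NumberTheory.NumberFields.MonicCubic

namespace Literature.NumberTheory.CubicFields.CubicDisc31

variable {F : Type*} [Field F] [NumberField F] {α : F}

/-! ## §1 Signature `(1, 1)` -/

/-- **`F` has exactly one complex place** (`r₂ = 1`): `d_F = −31 < 0` has sign `(−1)^{r₂}`, and `r₁ + 2r₂ = 3`.
[cite: LMFDB, number field 3.1.31.1 (signature [1,1])] -/
theorem nrComplexPlaces_eq_one (h3 : finrank ℚ F = 3) (hα : Polynomial.aeval α (poly 0 1 (-1)) = 0) : nrComplexPlaces F = 1 := by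
  have hsum := card_add_two_mul_card_eq_rank F
  rw [h3] at hsum
  have hsign := NumberField.sign_discr F
  rw [discr_eq_neg_thirtyOne h3 hα] at hsign
  have hle : nrComplexPlaces F ≤ 1 := by omega
  rcases Nat.le_one_iff_eq_zero_or_eq_one.mp hle with h0 | h1
  · rw [h0, pow_zero, show (-31 : ℤ).sign = -1 from rfl] at hsign
    norm_num at hsign
  · exact h1

/-- **`F` has exactly one real place** (`r₁ = 1`). [cite: LMFDB, number field 3.1.31.1 (signature [1,1])] -/
theorem nrRealPlaces_eq_one (h3 : finrank ℚ F = 3) (hα : Polynomial.aeval α (poly 0 1 (-1)) = 0) : nrRealPlaces F = 1 := by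
  have hsum := card_add_two_mul_card_eq_rank F
  rw [h3, nrComplexPlaces_eq_one h3 hα] at hsum
  omega

/-- `F` has two infinite places. [cite: LMFDB, number field 3.1.31.1 (signature [1,1])] -/
theorem card_infinitePlace_eq_two (h3 : finrank ℚ F = 3) (hα : Polynomial.aeval α (poly 0 1 (-1)) = 0) :
    Fintype.card (InfinitePlace F) = 2 := by
  rw [card_eq_nrRealPlaces_add_nrComplexPlaces, nrRealPlaces_eq_one h3 hα, nrComplexPlaces_eq_one h3 hα]

/-! ## §2 Class number one -/

/-- **`𝓞_F` is a principal ideal domain** — Minkowski: `|d_F| = 31 < (2 (π/4) 3³/3!)² = 81π²/16`.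
[cite: LMFDB, number field 3.1.31.1 (class number 1)] -/
theorem isPrincipalIdealRing (h3 : finrank ℚ F = 3) (hα : Polynomial.aeval α (poly 0 1 (-1)) = 0) : IsPrincipalIdealRing (𝓞 F) := by
  apply RingOfIntegers.isPrincipalIdealRing_of_abs_discr_lt
  rw [nrComplexPlaces_eq_one h3 hα, h3, discr_eq_neg_thirtyOne h3 hα]
  have hπ := Real.pi_gt_three
  norm_num [Nat.factorial]
  nlinarith [hπ, Real.pi_pos]

/-- **`h_F = 1`.** [cite: LMFDB, number field 3.1.31.1 (class number 1)] -/
theorem classNumber_eq_one (h3 : finrank ℚ F = 3) (hα : Polynomial.aeval α (poly 0 1 (-1)) = 0) : classNumber F = 1 :=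
  (classNumber_eq_one_iff (K := F)).mpr (isPrincipalIdealRing h3 hα)

/-! ## §3 Units -/

/-- **The unit group of `𝓞_F` has rank `1`** (`r₁ + r₂ − 1`; `α` itself is a unit, `N(α) = 1`). [cite: LMFDB, number field 3.1.31.1 (unit rank 1)] -/
theorem units_rank_eq_one (h3 : finrank ℚ F = 3) (hα : Polynomial.aeval α (poly 0 1 (-1)) = 0) : Units.rank F = 1 := by
  rw [Units.rank, card_infinitePlace_eq_two h3 hα]

end Literature.NumberTheory.CubicFields.CubicDisc31
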